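import Summits.QuantumFields.BalabanUV.Beta.GAN24.ChargeTowerClimb

/-!
# `BalabanUV.Beta.GAN24.ChargeTowerClimbZero` — binder row G-an2-4 ∕ (CONV-C), the (S) row ∕ (W-γ) AT EVERY LEVEL («the Δ_j-exact charge tower», road-P2 gen 41, memo
# `HOME/b2b-balaban-gan24-p2/gen41/W-GAMMA-TOWER-v0.md`): **THE FIRST RUNG** — the level `0 → 1` companion of `ChargeTowerClimb` §5–§7: a `(d*d)`-EXACT-PLUS-CONSTANT slot field read
# through the co-dressed one-step resolvent `G_0` is `Δ_1`-exact plus constant (potential `(a∕wVH_1)·𝒬_{Lc} m` for the image `a·d*d m`, constant `c_ν·Lc^d·(Lc^{d+1})⁻¹`), for a generic local stencil family and for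
# the pure S member at level `1` — the socket into which (I3)_0 (leaf-02 g57's `SrecChargeBlockPotentials`: the level-0 charge functions ARE `cE·(−¼)·d*d m`) plugs

NOT IN PRINT; OUR BOOKKEEPING ([folklore] by name: leaf-06 g46's level-0 pairing through `ChargeTowerClimb.tsum_sum_curvAdj_curv_mul_colH_zero_eq_E2`, the dictionary
`colM (KInvStep Lc 0) = wΦ_{Lc^1}` (gan24-leaf-14 `MultiplierZeroMass.colM_KInvStep`), `TransverseDictionary.wΦ_symm`, the Literature bounds `KKTFluctuationEnergy.abs_curv_le` ∕
`ResolventComposition.abs_curvAdj_le`, my column total and (I1) `ChargeTowerStep` at `j = 0`; 0 `def`, 0 cited fact, 0 `def … : Prop`, 0 sorry).  HONEST FRAMING (cell contract, verbatim):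
«discharging `BetaPertH` makes Bałaban's UV stability UNCONDITIONAL — a real constructive-QFT result; it is NOT the continuum limit and NOT the Clay problem.»  HONEST DEPENDENCY (verbatim):
«continuum YM on T⁴ ⇐ BetaPertH ∧ nine spine estimates (0/9 proved); BetaPertH ⇐ (D1) ∧ (D4) ∧ CAP+tail; G-an2-4 gates asym, D1 and NE2/3/4.»

Notation as in `ChargeTowerClimb`; `σ_0 = stepScale d Lc 0 = 1` is kept symbolic so that the statements are the `j = 0` instances of the ladder's shapes, and the level-1 output is written
LITERALLY in the hypothesis shape of `ChargeTowerClimb` §6∕§7 at `j = 0` (`wVH d Lc (0+1)·Σ'_v Σ_l wΦ_{Lc^{0+1}} ν l (y′ − v)·m′ l v + c′ ν`).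
* §1 **`tsum_sum_curvAdj_curv_mul_colH_zero_climbs`** (`Σ'_u Σ_κ (d*d m)(κ,u)·colH G_0 Lc ν y′ κ u = wVH_1·Σ'_y Σ_κ wΦ_{Lc^1} ν κ (y′ − y)·(wVH_1⁻¹·(𝒬m) κ y)`).
  `tsum_sum_smul_curvAdj_curv_mul_colH_zero_climbs` (the same with an outer scalar `a`: potential `(a∕wVH_1)·𝒬m`).
* §2 **`sum_tsum_colH_mul_affine_zero`** (consumer's order: `Σ_κ Σ'_u colH G_0 Lc ν y′ κ u·(a·(d*d m)(κ,u) + c κ) = (Δ_1 m′)(ν,y′) + c ν·Lc^d·(σ_0·Lc^{d+1})⁻¹`, `m′ = (a∕wVH_1)·𝒬_{Lc} m`).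
* §3 **`tsum_weighted_vertexOfK_zero_of_exact_add_const`** (generic local stencil family `S`, bounded weights: (I3)_0 for `S` against `g₁ ⊗ g₂` in the `a·d*d m + c` form ⇒ the weighted charge of
  `vertexOfK G_0 Lc S ν y′` is `(Δ_1 m′)(ν,y′) + c′ ν`).
* §4 **`hasSum_prod_coordWeighted_SpureRecAt_one_of_exact_add_const`** (THE FIRST S-PURE RUNG: (I3)_0 for the FULL member `SrecAt 0` against exit-supported block-constant weights ⇒ the
  class-𝒟 charge function of `SpureRecAt 1` has the sum `(cE·wE_1)·cH_0²·((Δ_1 m′)(ν,y′) + c′ ν)` — the level where (W-γ)'s exit sub-row is first open (jb = 1; E28 (B): `Δ₁ = E2[1]`-exact to 2e-15–2e-14)).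
Asserts NO value of Bałaban's tables; (I3)_0 itself is NOT proved here (leaf-02 g57); discharges NOTHING of (W-γ)'s exit sub-row ∕ (INV) ∕ (S) ∕ (Q-R) ∕ (LT) ∕ (Q-L) ∕ (C) ∕ «T2Shape» ∕
«T2Drift» ∕ (hW, hWall); NEVER «G-an2-4 closed» as (CONV-C); NOT D1, NOT `BetaPertH`, NOT continuum, NOT Clay.  2026-08-22; no existing file touched.
-/

noncomputable section

open Finset
open scoped BigOperators
open Literature.MathematicalPhysics.QuantumFieldTheory
open Literature.MathematicalPhysics.QuantumFieldTheory.Balaban1983to89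
open Literature.MathematicalPhysics.QuantumFieldTheory.Balaban1983to89.Beta
open ExpKernelCalculus (Site MKer Decays)
open AffineAveraging (Form1 box toSite contourSum curv curvAdj)
open AveragingContours (blk)
open KernelSpecInstance (wΦ)
open OneStepResolventKernel (Fib LocStencil)
open OneStepKernelFamily (KInvStep colH vertexOfK)
open SecondOrderResponse (colM)
open BalabanStepJetsSucc (E2 wVH wE)
open KKTFluctuationEnergy (abs_curv_le)
open ResolventComposition (abs_curvAdj_le)
open Summit.QuantumFields.BalabanUV.Beta.AxialDressingRooted (IsCombBondAt coDressKBmAt decays_coDressKBmAt_KInvStep one_le_of_neZero)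
open Summit.QuantumFields.BalabanUV.Beta.BorderedHessian (stepScale)
open Summit.QuantumFields.BalabanUV.Beta.SpineRooted (SpureRecAt)
open Summit.QuantumFields.BalabanUV.Beta.WardLocusRecursive (SrecAt locStencil_SrecAt)
open Summit.QuantumFields.BalabanUV.Beta.KernelWardMColumn (colM_coDressKBmAt)
open Summit.QuantumFields.BalabanUV.Beta.GAN24.MultiplierZeroMass (colM_KInvStep)
open Summit.QuantumFields.BalabanUV.Beta.GAN24.TransverseDictionary (wΦ_symm)
open Summit.QuantumFields.BalabanUV.Beta.WardLocusSecondOrder (colM_coDressKBmAt_KInvStep)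
open Summit.QuantumFields.BalabanUV.Beta.GAN24.ChargeTowerStep (tsum_weighted_vertexOfK hasSum_prod_coordWeighted_SpureRecAt_succ_inl_inl)
open Summit.QuantumFields.BalabanUV.Beta.GAN24.ChargeTowerClimb (summable_colH summable_bdd_mul_colH tsum_sum_const_mul_colH tsum_sum_curvAdj_curv_mul_colH_zero_eq_E2 ite_and_mul_eq)

namespace Summit.QuantumFields.BalabanUV.Beta.GAN24.ChargeTowerClimbZero

variable {d : ℕ} {Lc : ℕ} [NeZero Lc] {r : Fin (d + 1) → ℕ}

/-! ## §1 The level-0 climb in the `Δ_1` shape (`|(d*d m)| ≤ 16(d+1)B` by the Literature bounds `abs_curv_le` ∕ `abs_curvAdj_le`, as in leaf-06 g47's `CombFreeGaugeLegCharges.abs_curvAdj_curv_le`) -/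

/-- NOT IN PRINT; OUR BOOKKEEPING.  **THE LEVEL-0 CLIMB IN THE `Δ_1` SHAPE** (in-block root, `m` bounded and zero on the comb bonds):
`Σ'_u Σ_κ (d*d m)(κ,u)·colH G_0 Lc ν y′ κ u = wVH_1·Σ'_y Σ_κ wΦ_{Lc^1} ν κ (y′ − y)·(wVH_1⁻¹·(𝒬_{Lc} m) κ y)` — `ChargeTowerClimb` §4 with `E2 d Lc 1 y y′ (inl κ)(inl ν) = colM (KInvStep Lc 0) Lc ν y′ κ y
= wΦ_{Lc^1} κ ν (y − y′) = wΦ_{Lc^1} ν κ (y′ − y)`; the right side is `(Δ_1 m′)(ν,y′)`, `m′ = wVH_1⁻¹·𝒬_{Lc} m`, in the shape `ChargeTowerClimb` §6∕§7 consume at `j = 0`. -/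
theorem tsum_sum_curvAdj_curv_mul_colH_zero_climbs (hr : r ∈ box (d + 1) Lc) {m : Form1 (d + 1) ℝ} {B : ℝ} (hmB : ∀ κ u, |m κ u| ≤ B)
    (hm0 : ∀ κ u, IsCombBondAt (toSite r) Lc κ u → m κ u = 0) (ν : Fin (d + 1)) (y' : Site (d + 1)) :
    ∑' u, ∑ κ, curvAdj (curv m) κ u * colH (coDressKBmAt (toSite r) Lc (KInvStep (d := d) Lc 0)) Lc ν y' κ u
      = wVH d Lc (0 + 1) * ∑' y, ∑ κ, wΦ (N := Lc ^ (0 + 1)) ν κ (y' - y) * ((wVH d Lc (0 + 1))⁻¹ * contourSum Lc m κ y) := by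
  rw [tsum_sum_curvAdj_curv_mul_colH_zero_eq_E2 hr hmB hm0 ν y']
  have hw : wVH d Lc (0 + 1) ≠ 0 := by
    simp only [wVH]
    exact pow_ne_zero _ (pow_ne_zero _ (by exact_mod_cast NeZero.ne Lc))
  have e : ∀ y κ, E2 d Lc 1 y y' (Sum.inl κ) (Sum.inl ν) * contourSum Lc m κ y = wΦ (N := Lc ^ (0 + 1)) ν κ (y' - y) * contourSum Lc m κ y := by
    intro y κ
    rw [← colM_coDressKBmAt_KInvStep (toSite r) 0 ν y' κ y, colM_coDressKBmAt, colM_KInvStep, wΦ_symm κ ν (y - y'), neg_sub]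
  simp only [e]
  have e2 : ∀ y, ∑ κ, wΦ (N := Lc ^ (0 + 1)) ν κ (y' - y) * ((wVH d Lc (0 + 1))⁻¹ * contourSum Lc m κ y)
      = (wVH d Lc (0 + 1))⁻¹ * ∑ κ, wΦ (N := Lc ^ (0 + 1)) ν κ (y' - y) * contourSum Lc m κ y := by
    intro y
    rw [Finset.mul_sum]
    exact Finset.sum_congr rfl fun κ _ => by ring
  simp only [e2]
  rw [tsum_mul_left, ← mul_assoc, mul_inv_cancel₀ hw, one_mul]

/-- NOT IN PRINT; OUR BOOKKEEPING.  The same with an outer scalar `a` on the Wilson-Hessian image (leaf-02 g57's (I3)_0 carries `a = cE·(−¼)`):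
`Σ'_u Σ_κ (a·(d*d m)(κ,u))·colH G_0 Lc ν y′ κ u = wVH_1·Σ'_y Σ_κ wΦ_{Lc^1} ν κ (y′ − y)·((a∕wVH_1)·(𝒬_{Lc} m) κ y)`. -/
theorem tsum_sum_smul_curvAdj_curv_mul_colH_zero_climbs (hr : r ∈ box (d + 1) Lc) {m : Form1 (d + 1) ℝ} {B : ℝ} (hmB : ∀ κ u, |m κ u| ≤ B)
    (hm0 : ∀ κ u, IsCombBondAt (toSite r) Lc κ u → m κ u = 0) (a : ℝ) (ν : Fin (d + 1)) (y' : Site (d + 1)) :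
    ∑' u, ∑ κ, (a * curvAdj (curv m) κ u) * colH (coDressKBmAt (toSite r) Lc (KInvStep (d := d) Lc 0)) Lc ν y' κ u
      = wVH d Lc (0 + 1) * ∑' y, ∑ κ, wΦ (N := Lc ^ (0 + 1)) ν κ (y' - y) * ((a / wVH d Lc (0 + 1)) * contourSum Lc m κ y) := by
  have hw : wVH d Lc (0 + 1) ≠ 0 := by
    simp only [wVH]
    exact pow_ne_zero _ (pow_ne_zero _ (by exact_mod_cast NeZero.ne Lc))
  have e1 : ∀ u, ∑ κ, (a * curvAdj (curv m) κ u) * colH (coDressKBmAt (toSite r) Lc (KInvStep (d := d) Lc 0)) Lc ν y' κ u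
      = a * ∑ κ, curvAdj (curv m) κ u * colH (coDressKBmAt (toSite r) Lc (KInvStep (d := d) Lc 0)) Lc ν y' κ u := by
    intro u
    rw [Finset.mul_sum]
    exact Finset.sum_congr rfl fun κ _ => by ring
  have e2 : ∀ y, ∑ κ, wΦ (N := Lc ^ (0 + 1)) ν κ (y' - y) * ((a / wVH d Lc (0 + 1)) * contourSum Lc m κ y)
      = (a / wVH d Lc (0 + 1)) * ∑ κ, wΦ (N := Lc ^ (0 + 1)) ν κ (y' - y) * contourSum Lc m κ y := by
    intro y
    rw [Finset.mul_sum]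
    exact Finset.sum_congr rfl fun κ _ => by ring
  have e3 : ∀ y, ∑ κ, wΦ (N := Lc ^ (0 + 1)) ν κ (y' - y) * ((wVH d Lc (0 + 1))⁻¹ * contourSum Lc m κ y)
      = (wVH d Lc (0 + 1))⁻¹ * ∑ κ, wΦ (N := Lc ^ (0 + 1)) ν κ (y' - y) * contourSum Lc m κ y := by
    intro y
    rw [Finset.mul_sum]
    exact Finset.sum_congr rfl fun κ _ => by ring
  simp only [e1, e2]
  rw [tsum_mul_left, tsum_sum_curvAdj_curv_mul_colH_zero_climbs hr hmB hm0 ν y']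
  simp only [e3]
  rw [tsum_mul_left, tsum_mul_left]
  field_simp

/-! ## §2 The affine step at level 0 in the consumer's order -/

/-- NOT IN PRINT; OUR BOOKKEEPING.  **THE FIRST AFFINE RUNG** (in-block root; `m` bounded and zero on the comb bonds; scalar `a`; `c` per-direction constants): for
`C κ u := a·(d*d m)(κ,u) + c κ`, `Σ_κ Σ'_u colH G_0 Lc ν y′ κ u·C κ u = wVH_1·Σ'_y Σ_κ wΦ_{Lc^1} ν κ (y′ − y)·((a∕wVH_1)·(𝒬m) κ y) + c ν·(Lc^d·(σ_0·Lc^{d+1})⁻¹)`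
(§1 + `ChargeTowerClimb.tsum_sum_const_mul_colH` at `j = 0`). -/
theorem sum_tsum_colH_mul_affine_zero (hr : r ∈ box (d + 1) Lc) {m : Form1 (d + 1) ℝ} {B : ℝ} (hmB : ∀ κ u, |m κ u| ≤ B)
    (hm0 : ∀ κ u, IsCombBondAt (toSite r) Lc κ u → m κ u = 0) (a : ℝ) (c : Fin (d + 1) → ℝ) (ν : Fin (d + 1)) (y' : Site (d + 1)) :
    ∑ κ, ∑' u, colH (coDressKBmAt (toSite r) Lc (KInvStep (d := d) Lc 0)) Lc ν y' κ u * (a * curvAdj (curv m) κ u + c κ)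
      = wVH d Lc (0 + 1) * (∑' y, ∑ κ, wΦ (N := Lc ^ (0 + 1)) ν κ (y' - y) * ((a / wVH d Lc (0 + 1)) * contourSum Lc m κ y))
        + c ν * ((Lc : ℝ) ^ d * (stepScale d Lc 0 * (Lc : ℝ) ^ (d + 1))⁻¹) := by
  classical
  have hB0 : 0 ≤ B := (abs_nonneg _).trans (hmB 0 0)
  have hsE : ∀ κ, Summable fun u => (a * curvAdj (curv m) κ u) * colH (coDressKBmAt (toSite r) Lc (KInvStep (d := d) Lc 0)) Lc ν y' κ u := fun κ =>
    summable_bdd_mul_colH hr 0 (A := fun κ u => a * curvAdj (curv m) κ u) (B := |a| * (((d + 1 : ℕ) : ℝ) * (2 * (4 * B)) + ((d + 1 : ℕ) : ℝ) * (2 * (4 * B))))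
      (fun κ u => by rw [abs_mul]; exact mul_le_mul_of_nonneg_left (abs_curvAdj_le (fun κ l x => abs_curv_le hmB κ l x) κ u) (abs_nonneg _)) ν y' κ
  have hsc : ∀ κ, Summable fun u => c κ * colH (coDressKBmAt (toSite r) Lc (KInvStep (d := d) Lc 0)) Lc ν y' κ u := fun κ =>
    (summable_colH hr 0 ν y' κ).mul_left (c κ)
  have hsplit : ∀ κ, ∑' u, colH (coDressKBmAt (toSite r) Lc (KInvStep (d := d) Lc 0)) Lc ν y' κ u * (a * curvAdj (curv m) κ u + c κ)
      = (∑' u, (a * curvAdj (curv m) κ u) * colH (coDressKBmAt (toSite r) Lc (KInvStep (d := d) Lc 0)) Lc ν y' κ u)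
        + ∑' u, c κ * colH (coDressKBmAt (toSite r) Lc (KInvStep (d := d) Lc 0)) Lc ν y' κ u := by
    intro κ
    rw [← (hsE κ).tsum_add (hsc κ)]
    exact tsum_congr fun u => by ring
  simp only [hsplit]
  rw [Finset.sum_add_distrib, ← Summable.tsum_finsetSum (fun κ _ => hsE κ), ← Summable.tsum_finsetSum (fun κ _ => hsc κ),
    tsum_sum_smul_curvAdj_curv_mul_colH_zero_climbs hr hmB hm0 a ν y', tsum_sum_const_mul_colH hr 0 c ν y']

/-! ## §3 The first rung for a generic local stencil family -/

/-- NOT IN PRINT; OUR BOOKKEEPING.  **THE FIRST RUNG FOR A GENERIC LOCAL STENCIL FAMILY** (in-block root; `S` local, `g₁ g₂` bounded; `m` bounded and zero on the comb bonds; `c` constants):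
IF `∀ κ u, Σ'_{(y,w)} g₁(y)·g₂(w)·S κ u y w e f = a·(d*d m)(κ,u) + c κ` ((I3)_0 for `S` against `g₁ ⊗ g₂`, the Wilson-Hessian shape with an outer scalar) THEN
`Σ'_{(y,w)} g₁(y)·(vertexOfK G_0 Lc S ν y′) y w e f·g₂(w) = wVH_1·Σ'_y Σ_κ wΦ_{Lc^1} ν κ (y′ − y)·((a∕wVH_1)·(𝒬m) κ y) + c ν·(Lc^d·(σ_0·Lc^{d+1})⁻¹)` — `Δ_1`-exact plus constant
(`ChargeTowerStep.tsum_weighted_vertexOfK` ⨾ §2). -/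
theorem tsum_weighted_vertexOfK_zero_of_exact_add_const (hr : r ∈ box (d + 1) Lc)
    {S : Fin (d + 1) → Site (d + 1) → MKer (d + 1) (Fib d)} {Cs δs : ℝ} (hS : LocStencil S Cs δs) (hδs : 0 < δs)
    (g₁ g₂ : Site (d + 1) → ℝ) {B₁ B₂ : ℝ} (hg₁ : ∀ y, |g₁ y| ≤ B₁) (hg₂ : ∀ w, |g₂ w| ≤ B₂) (e f : Fib d)
    {m : Form1 (d + 1) ℝ} {B : ℝ} (hmB : ∀ κ u, |m κ u| ≤ B) (hm0 : ∀ κ u, IsCombBondAt (toSite r) Lc κ u → m κ u = 0) (a : ℝ) (c : Fin (d + 1) → ℝ)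
    (hC : ∀ (κ : Fin (d + 1)) (u : Site (d + 1)), ∑' yw : Site (d + 1) × Site (d + 1), g₁ yw.1 * g₂ yw.2 * S κ u yw.1 yw.2 e f
      = a * curvAdj (curv m) κ u + c κ)
    (ν : Fin (d + 1)) (y' : Site (d + 1)) :
    ∑' yw : Site (d + 1) × Site (d + 1), g₁ yw.1 * vertexOfK (coDressKBmAt (toSite r) Lc (KInvStep (d := d) Lc 0)) Lc S ν y' yw.1 yw.2 e f * g₂ yw.2
      = wVH d Lc (0 + 1) * (∑' y, ∑ κ, wΦ (N := Lc ^ (0 + 1)) ν κ (y' - y) * ((a / wVH d Lc (0 + 1)) * contourSum Lc m κ y))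
        + c ν * ((Lc : ℝ) ^ d * (stepScale d Lc 0 * (Lc : ℝ) ^ (d + 1))⁻¹) := by
  obtain ⟨δ, C, hδ, -, hG⟩ := decays_coDressKBmAt_KInvStep (d := d) hr 0
  rw [tsum_weighted_vertexOfK (one_le_of_neZero Lc) hG hδ hS hδs ν y' g₁ g₂ hg₁ hg₂ e f]
  simp only [hC]
  exact sum_tsum_colH_mul_affine_zero hr hmB hm0 a c ν y'

/-! ## §4 The first S-pure rung: level `1` -/

/-- NOT IN PRINT; OUR BOOKKEEPING.  **THE FIRST S-PURE RUNG OF THE TOWER** (in-block root, all `cE cVH cΛ`, bounded `f₁ f₂ : ℤ → ℝ`, `m` bounded and zero on the comb bonds, constants `c`): IF the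
charge function of the FULL level-0 member `SrecAt … 0` (Wilson letter + `Λ_0` + rooted border) against the exit-supported block-constant weights `g₁ = 𝟙^{exit}_α·f₁∘blk_α`,
`g₂ = 𝟙^{exit}_β·f₂∘blk_β` in channel `(inl α, inl β)` is `a·(d*d m) + c` ((I3)_0 — leaf-02 g57's `SrecChargeBlockPotentials.hasSum_prod_exitWt_srecAt_zero` supplies it with
`a = cE·(−¼)`, `c = 0` on class 𝒟), THEN
`HasSum ((x,z) ↦ f₁(x_α)·f₂(z_β)·SpureRecAt … 1 ν y′ x z (inl α)(inl β)) ((cE·wE_1)·cH_0²·(wVH_1·Σ'_y Σ_κ wΦ_{Lc^1} ν κ (y′ − y)·((a∕wVH_1)·(𝒬_{Lc} m) κ y) + c ν·Lc^d·(σ_0·Lc^{d+1})⁻¹))`,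
`cH_0 = (σ_0·Lc^{d+1})⁻¹ = (Lc^{d+1})⁻¹` — the level-1 class-𝒟 charge function is `Δ_1`-EXACT PLUS CONSTANT in the slot, in the hypothesis shape of `ChargeTowerClimb` §7 at `j = 0`
((I1) `ChargeTowerStep.hasSum_prod_coordWeighted_SpureRecAt_succ_inl_inl` at `j = 0` ⨾ §3).  Re-gauging `m′ = wVH_1⁻¹·𝒬m` bounded and off the comb is NOT done here. -/
theorem hasSum_prod_coordWeighted_SpureRecAt_one_of_exact_add_const (hr : r ∈ box (d + 1) Lc) (cE cVH cΛ : ℝ) (α β : Fin (d + 1))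
    (f₁ f₂ : ℤ → ℝ) {B₁ B₂ : ℝ} (hf₁ : ∀ s, |f₁ s| ≤ B₁) (hf₂ : ∀ s, |f₂ s| ≤ B₂)
    {m : Form1 (d + 1) ℝ} {B : ℝ} (hmB : ∀ κ u, |m κ u| ≤ B) (hm0 : ∀ κ u, IsCombBondAt (toSite r) Lc κ u → m κ u = 0) (a : ℝ) (c : Fin (d + 1) → ℝ)
    (hC : ∀ (κ : Fin (d + 1)) (u : Site (d + 1)), ∑' yw : Site (d + 1) × Site (d + 1),
        (if yw.1 α % (Lc : ℤ) = (Lc : ℤ) - 1 then f₁ (blk Lc yw.1 α) else 0) * (if yw.2 β % (Lc : ℤ) = (Lc : ℤ) - 1 then f₂ (blk Lc yw.2 β) else 0)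
          * SrecAt d Lc (toSite r) cE cVH cΛ 0 κ u yw.1 yw.2 (Sum.inl α) (Sum.inl β)
      = a * curvAdj (curv m) κ u + c κ)
    (ν : Fin (d + 1)) (y' : Site (d + 1)) :
    HasSum (fun xz : Site (d + 1) × Site (d + 1) => f₁ (xz.1 α) * f₂ (xz.2 β) *
        SpureRecAt d Lc (toSite r) cE cVH cΛ 1 ν y' xz.1 xz.2 (Sum.inl α) (Sum.inl β))
      ((cE * wE d Lc 1) * ((stepScale d Lc 0 * (Lc : ℝ) ^ (d + 1))⁻¹ ^ 2 *
        (wVH d Lc (0 + 1) * (∑' y, ∑ κ, wΦ (N := Lc ^ (0 + 1)) ν κ (y' - y) * ((a / wVH d Lc (0 + 1)) * contourSum Lc m κ y))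
          + c ν * ((Lc : ℝ) ^ d * (stepScale d Lc 0 * (Lc : ℝ) ^ (d + 1))⁻¹)))) := by
  classical
  have hLc : 1 ≤ Lc := one_le_of_neZero Lc
  obtain ⟨Cs, δs, hδs, hS⟩ := locStencil_SrecAt (d := d) (Lc := Lc) hLc hr cE cVH cΛ 0
  have hB₁ : 0 ≤ B₁ := (abs_nonneg _).trans (hf₁ 0)
  have hB₂ : 0 ≤ B₂ := (abs_nonneg _).trans (hf₂ 0)
  set g₁ : Site (d + 1) → ℝ := fun y => if y α % (Lc : ℤ) = (Lc : ℤ) - 1 then f₁ (blk Lc y α) else 0 with hg₁def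
  set g₂ : Site (d + 1) → ℝ := fun w => if w β % (Lc : ℤ) = (Lc : ℤ) - 1 then f₂ (blk Lc w β) else 0 with hg₂def
  have hg₁ : ∀ y, |g₁ y| ≤ B₁ := fun y => by
    simp only [hg₁def]; split_ifs
    · exact hf₁ _
    · rw [abs_zero]; exact hB₁
  have hg₂ : ∀ w, |g₂ w| ≤ B₂ := fun w => by
    simp only [hg₂def]; split_ifs
    · exact hf₂ _
    · rw [abs_zero]; exact hB₂
  have hC' : ∀ (κ : Fin (d + 1)) (u : Site (d + 1)), ∑' yw : Site (d + 1) × Site (d + 1),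
      g₁ yw.1 * g₂ yw.2 * SrecAt d Lc (toSite r) cE cVH cΛ 0 κ u yw.1 yw.2 (Sum.inl α) (Sum.inl β) = a * curvAdj (curv m) κ u + c κ := fun κ u => by
    simp only [hg₁def, hg₂def]; exact hC κ u
  have key := tsum_weighted_vertexOfK_zero_of_exact_add_const hr hS hδs g₁ g₂ hg₁ hg₂ (Sum.inl α) (Sum.inl β) hmB hm0 a c hC' ν y'
  have h := hasSum_prod_coordWeighted_SpureRecAt_succ_inl_inl hr cE cVH cΛ 0 ν y' α β f₁ f₂ hf₁ hf₂
  have e : (∑' yw : Site (d + 1) × Site (d + 1),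
      (if yw.1 α % (Lc : ℤ) = (Lc : ℤ) - 1 ∧ yw.2 β % (Lc : ℤ) = (Lc : ℤ) - 1 then
        f₁ (blk Lc yw.1 α) * f₂ (blk Lc yw.2 β) *
          vertexOfK (coDressKBmAt (toSite r) Lc (KInvStep (d := d) Lc 0)) Lc (SrecAt d Lc (toSite r) cE cVH cΛ 0) ν y' yw.1 yw.2
            (Sum.inl α) (Sum.inl β) else 0))
      = wVH d Lc (0 + 1) * (∑' y, ∑ κ, wΦ (N := Lc ^ (0 + 1)) ν κ (y' - y) * ((a / wVH d Lc (0 + 1)) * contourSum Lc m κ y))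
        + c ν * ((Lc : ℝ) ^ d * (stepScale d Lc 0 * (Lc : ℝ) ^ (d + 1))⁻¹) := by
    rw [← key]
    refine tsum_congr fun yw => ?_
    rw [ite_and_mul_eq]
  rw [e] at h
  exact h

end Summit.QuantumFields.BalabanUV.Beta.GAN24.ChargeTowerClimbZero

end
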